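import Literature.Topology.FourManifolds.LatticeFormsOrthoSumSignature
import Literature.Topology.FourManifolds.MorseTurnAbout
import Literature.Topology.FourManifolds.MorseAffine
import Literature.Topology.FourManifolds.MorseChartChange
import Literature.Topology.FourManifolds.TrisectionsRadialThickening
import HarnessLib

/-!
# Linear algebra and chain rules for the Hessian of a function of two flow-adapted variables

Topic `Literature/Topology/FourManifolds`; model-space layer (E1a) of the "flow rule" for the
fact seat `provefact-Literature.Topology.FourManifolds.exists_isBalancedGKTrisection`
(Gay–Kirby 2016, Thm. 4 via §4, Lemma 14).  Everything in this file is **proved**; the only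
definitions are three explicit linear maps/isomorphisms.

In a chart about a point `z₀` of a closed manifold carrying a Morse function `f` with
gradient-like field `ξ`, a function of the form `Ψ = Γ(φ̄, f)` — `φ̄` constant along the
trajectories of `ξ` (a function on a regular level pulled back by the projection along
trajectories), `Γ` a smooth function of two variables — has at a critical point
`D²Ψ = ∂₂₂Γ · Df ⊗ Df + ∂₁Γ · D²φ̄` (`fderiv_fderiv_comp₂_apply_of_fderiv_eq_zero`), where `D²φ̄`
kills the flow direction `ξ̂`.  The signature of such a form is read off blockwise:

* `LinearMap.BilinForm.sigNeg_eq_of_line_ker` — if `B(ξ, k) = B(k, ξ) = 0` for `k ∈ ker ℓ` and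
  `ℓ ξ ≠ 0`, then `b⁻(B) = [B(ξ, ξ) < 0] + b⁻(B|ker ℓ)` and `B` is nondegenerate iff
  `B(ξ, ξ) ≠ 0` and `B|ker ℓ` is (orthogonal splitting `E = ℝξ ⊕ ker ℓ`,
  `LinearMap.BilinForm.sigNeg_prod`);
* `LinearMap.BilinForm.sigNeg_restrict_ker_eq_of_radical` — if `ξ` lies in the radical of `Q`,
  the restrictions of `Q` to any two complements `ker ℓ₁`, `ker ℓ₂` of `ℝξ` have the same
  `b⁻` and are nondegenerate together (projection along `ξ`);
* `LinearMap.BilinForm.sigNeg_restrict_ker_eq_of_comp` — transport of restricted forms under a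
  linear isomorphism `A` with `ℓ' ∘ A = c ℓ`;
* `sigNeg_smul_of_neg` — `b⁻(c Q) = dim − b⁻(Q)` for `c < 0` and `Q` nondegenerate symmetric.

## References

* J. Milnor, *Morse theory* (1963), §2 (Hessian, index, Sylvester's law). [Milnor1963]
* J.-P. Serre, *A Course in Arithmetic* (1973), Ch. V §1.3.7 (additivity of the indices of
  inertia over orthogonal sums). [Serre1973]
-/

open Set Function Module
open Literature.Topology.FourManifolds

noncomputable section

namespace LinearMap.BilinForm

variable {E : Type*} [AddCommGroup E] [Module ℝ E]

/-! ### The orthogonal splitting `E = ℝ ξ ⊕ ker ℓ` -/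

/-- The linear map `(t, k) ↦ t ξ + k` from `ℝ × ker ℓ` to `E`. [folklore] -/
def lineKerMap (ξ : E) (ℓ : E →ₗ[ℝ] ℝ) : (ℝ × LinearMap.ker ℓ) →ₗ[ℝ] E :=
  LinearMap.coprod (LinearMap.toSpanSingleton ℝ E ξ) (LinearMap.ker ℓ).subtype

/-- `lineKerMap ξ ℓ (t, k) = t ξ + k`. [folklore] -/
@[simp] theorem lineKerMap_apply (ξ : E) (ℓ : E →ₗ[ℝ] ℝ) (x : ℝ × LinearMap.ker ℓ) :
    lineKerMap ξ ℓ x = x.1 • ξ + (x.2 : E) := by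
  simp [lineKerMap]

/-- For `ℓ ξ ≠ 0`, `(t, k) ↦ t ξ + k` is bijective (`E = ℝ ξ ⊕ ker ℓ`). [folklore] -/
theorem bijective_lineKerMap {ξ : E} {ℓ : E →ₗ[ℝ] ℝ} (hξ : ℓ ξ ≠ 0) :
    Bijective (lineKerMap ξ ℓ) := by
  constructor
  · rw [← LinearMap.ker_eq_bot, Submodule.eq_bot_iff]
    rintro ⟨t, k⟩ hx
    rw [LinearMap.mem_ker, lineKerMap_apply] at hx
    have h1 : t * ℓ ξ = 0 := by
      have := congrArg ℓ hx
      simpa [map_add, map_smul, (LinearMap.mem_ker.1 k.2)] using this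
    have ht : t = 0 := (mul_eq_zero.1 h1).resolve_right hξ
    have hk : (k : E) = 0 := by simpa [ht] using hx
    ext <;> simp [ht, hk]
  · intro v
    refine ⟨(ℓ v / ℓ ξ, ⟨v - (ℓ v / ℓ ξ) • ξ, ?_⟩), ?_⟩
    · rw [LinearMap.mem_ker, map_sub, map_smul, smul_eq_mul, div_mul_cancel₀ _ hξ, sub_self]
    · simp

/-- **The splitting isomorphism** `ℝ × ker ℓ ≃ E`, `(t, k) ↦ t ξ + k`, for `ℓ ξ ≠ 0`. [folklore] -/
def lineKerEquiv {ξ : E} {ℓ : E →ₗ[ℝ] ℝ} (hξ : ℓ ξ ≠ 0) : (ℝ × LinearMap.ker ℓ) ≃ₗ[ℝ] E :=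
  LinearEquiv.ofBijective (lineKerMap ξ ℓ) (bijective_lineKerMap hξ)

/-- `lineKerEquiv hξ (t, k) = t ξ + k`. [folklore] -/
@[simp] theorem lineKerEquiv_apply {ξ : E} {ℓ : E →ₗ[ℝ] ℝ} (hξ : ℓ ξ ≠ 0) (x : ℝ × LinearMap.ker ℓ) :
    lineKerEquiv hξ x = x.1 • ξ + (x.2 : E) := by
  simp [lineKerEquiv]

/-- The rank-one form `c · t t'` on `ℝ`. [folklore] -/
abbrev lineForm (c : ℝ) : LinearMap.BilinForm ℝ ℝ := c • (LinearMap.mul ℝ ℝ : ℝ →ₗ[ℝ] ℝ →ₗ[ℝ] ℝ)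

/-- `lineForm c t t' = c t t'`. [folklore] -/
@[simp] theorem lineForm_apply (c t t' : ℝ) : lineForm c t t' = c * (t * t') := by
  simp [lineForm]

/-- `lineForm c` is symmetric. [folklore] -/
theorem isSymm_lineForm (c : ℝ) : (lineForm c).IsSymm :=
  ⟨fun t t' => by simp [mul_comm]⟩

/-- **`b⁻` of the rank-one form `c t²`** is `1` if `c < 0` and `0` otherwise. [cite: Milnor1963, §2] -/
theorem sigNeg_lineForm (c : ℝ) : sigNeg (lineForm c).toQuadraticMap = if c < 0 then 1 else 0 := by
  have hQ : ∀ t : ℝ, (lineForm c).toQuadraticMap t = c * (t * t) := fun t => by simp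
  split_ifs with hc
  · apply le_antisymm
    · calc sigNeg (lineForm c).toQuadraticMap = sigPos (-(lineForm c).toQuadraticMap) := by
            rw [sigPos_neg]
        _ ≤ Module.finrank ℝ ℝ := sigPos_le_finrank _
        _ = 1 := Module.finrank_self ℝ
    · have hneg : ((-(lineForm c).toQuadraticMap).restrict ⊤).PosDef := by
        intro t ht
        have ht' : (t : ℝ) ≠ 0 := fun h => ht (Subtype.ext h)
        simp only [QuadraticMap.restrict_apply, QuadraticMap.neg_apply, hQ]
        nlinarith [mul_pos (neg_pos.2 hc) (mul_self_pos.2 ht')]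
      have := le_sigNeg_of_negDef _ hneg
      rw [finrank_top, Module.finrank_self] at this
      exact this
  · obtain ⟨W, hW, hneg⟩ := exists_finrank_eq_sigNeg_and_negDef (lineForm c).toQuadraticMap
    rw [← hW]
    have hbot : W = ⊥ := by
      rw [Submodule.eq_bot_iff]
      intro t ht
      by_contra h0
      have h := hneg ⟨t, ht⟩ (fun h' => h0 (congrArg Subtype.val h'))
      simp only [QuadraticMap.restrict_apply, QuadraticMap.neg_apply, hQ] at h
      have : 0 ≤ c * (t * t) := mul_nonneg (not_lt.1 hc) (mul_self_nonneg t)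
      linarith
    rw [hbot, finrank_bot]

/-- `lineForm c` is nondegenerate iff `c ≠ 0`. [folklore] -/
theorem nondegenerate_lineForm_iff (c : ℝ) : (lineForm c).Nondegenerate ↔ c ≠ 0 := by
  constructor
  · rintro ⟨h, -⟩ hc
    have := h 1 (fun t => by simp [hc])
    exact one_ne_zero this
  · intro hc
    refine ⟨fun t ht => ?_, fun t ht => ?_⟩
    · have := ht 1
      simp only [lineForm_apply, mul_one, mul_eq_zero, hc, false_or] at this
      exact this
    · have := ht 1
      simp only [lineForm_apply, one_mul, mul_eq_zero, hc, false_or] at this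
      exact this

/-- An orthogonal sum is nondegenerate iff both summands are. [cite: Serre1973, Ch. V §1.2] -/
theorem nondegenerate_prod_iff {M₁ M₂ : Type*} [AddCommGroup M₁] [Module ℝ M₁] [AddCommGroup M₂]
    [Module ℝ M₂] (B₁ : LinearMap.BilinForm ℝ M₁) (B₂ : LinearMap.BilinForm ℝ M₂) :
    (B₁.prod B₂).Nondegenerate ↔ B₁.Nondegenerate ∧ B₂.Nondegenerate := by
  constructor
  · rintro ⟨hl, hr⟩
    refine ⟨⟨fun x hx => ?_, fun x hx => ?_⟩, ⟨fun x hx => ?_, fun x hx => ?_⟩⟩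
    · have := hl (x, 0) (fun y => by simp [prod_apply, hx y.1])
      exact (Prod.mk_eq_zero.1 this).1
    · have := hr (x, 0) (fun y => by simp [prod_apply, hx y.1])
      exact (Prod.mk_eq_zero.1 this).1
    · have := hl (0, x) (fun y => by simp [prod_apply, hx y.2])
      exact (Prod.mk_eq_zero.1 this).2
    · have := hr (0, x) (fun y => by simp [prod_apply, hx y.2])
      exact (Prod.mk_eq_zero.1 this).2
  · rintro ⟨⟨h1l, h1r⟩, ⟨h2l, h2r⟩⟩
    refine ⟨fun x hx => ?_, fun x hx => ?_⟩
    · have hx1 : x.1 = 0 := h1l x.1 (fun y => by simpa [prod_apply] using hx (y, 0))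
      have hx2 : x.2 = 0 := h2l x.2 (fun y => by simpa [prod_apply] using hx (0, y))
      exact Prod.ext hx1 hx2
    · have hx1 : x.1 = 0 := h1r x.1 (fun y => by simpa [prod_apply] using hx (y, 0))
      have hx2 : x.2 = 0 := h2r x.2 (fun y => by simpa [prod_apply] using hx (0, y))
      exact Prod.ext hx1 hx2

/-- **Block decomposition.**  If `ℓ ξ ≠ 0` and `B(ξ, k) = B(k, ξ) = 0` for all `k ∈ ker ℓ`,
then under `E = ℝξ ⊕ ker ℓ` the form `B` is the orthogonal sum of `B(ξ, ξ) t t'` and `B|ker ℓ`.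
[cite: Serre1973, Ch. V §1.2] -/
theorem apply_lineKerEquiv (B : LinearMap.BilinForm ℝ E) {ξ : E} {ℓ : E →ₗ[ℝ] ℝ} (hξ : ℓ ξ ≠ 0)
    (hcross : ∀ k ∈ LinearMap.ker ℓ, B ξ k = 0 ∧ B k ξ = 0) (x y : ℝ × LinearMap.ker ℓ) :
    B (lineKerEquiv hξ x) (lineKerEquiv hξ y) =
      ((lineForm (B ξ ξ)).prod (B.restrict (LinearMap.ker ℓ))) x y := by
  obtain ⟨h1, -⟩ := hcross y.2 y.2.2
  obtain ⟨-, h2⟩ := hcross x.2 x.2.2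
  simp only [lineKerEquiv_apply, map_add, map_smul, LinearMap.add_apply, LinearMap.smul_apply,
    smul_eq_mul, h1, h2, mul_zero, add_zero, zero_add, prod_apply, restrict_apply,
    LinearMap.domRestrict_apply, LinearMap.smul_apply, LinearMap.mul_apply']
  ring

/-- **`b⁻` over the splitting `E = ℝξ ⊕ ker ℓ`**: for a symmetric form `B` on a
finite-dimensional space with `B(ξ, ker ℓ) = 0`, `ℓ ξ ≠ 0`:
`b⁻(B) = [B(ξ, ξ) < 0] + b⁻(B|ker ℓ)`. [cite: Milnor1963, §2] [cite: Serre1973, Ch. V §1.3.7] -/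
theorem sigNeg_eq_of_line_ker [FiniteDimensional ℝ E] (B : LinearMap.BilinForm ℝ E) (hB : B.IsSymm)
    {ξ : E} {ℓ : E →ₗ[ℝ] ℝ} (hξ : ℓ ξ ≠ 0)
    (hcross : ∀ k ∈ LinearMap.ker ℓ, B ξ k = 0 ∧ B k ξ = 0) :
    sigNeg B.toQuadraticMap =
      (if B ξ ξ < 0 then 1 else 0) + sigNeg (B.restrict (LinearMap.ker ℓ)).toQuadraticMap := by
  have hres : (B.restrict (LinearMap.ker ℓ)).IsSymm :=
    ⟨fun x y => by simp only [restrict_apply, LinearMap.domRestrict_apply]; exact hB.eq _ _⟩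
  have h1 : sigNeg ((lineForm (B ξ ξ)).prod (B.restrict (LinearMap.ker ℓ))).toQuadraticMap =
      sigNeg B.toQuadraticMap :=
    sigNeg_eq_of_forall_apply_eq (lineKerEquiv hξ) fun x y => (B.apply_lineKerEquiv hξ hcross x y).symm
  rw [← h1, sigNeg_prod _ _ (isSymm_lineForm _) hres, sigNeg_lineForm]

/-- **Nondegeneracy over the splitting `E = ℝξ ⊕ ker ℓ`**: `B` is nondegenerate iff
`B(ξ, ξ) ≠ 0` and `B|ker ℓ` is nondegenerate. [cite: Serre1973, Ch. V §1.2] -/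
theorem nondegenerate_iff_of_line_ker (B : LinearMap.BilinForm ℝ E) {ξ : E} {ℓ : E →ₗ[ℝ] ℝ}
    (hξ : ℓ ξ ≠ 0) (hcross : ∀ k ∈ LinearMap.ker ℓ, B ξ k = 0 ∧ B k ξ = 0) :
    B.Nondegenerate ↔ B ξ ξ ≠ 0 ∧ (B.restrict (LinearMap.ker ℓ)).Nondegenerate := by
  have h1 : ((lineForm (B ξ ξ)).prod (B.restrict (LinearMap.ker ℓ))).Nondegenerate ↔ B.Nondegenerate :=
    nondegenerate_iff_of_forall_apply_eq (lineKerEquiv hξ)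
      fun x y => (B.apply_lineKerEquiv hξ hcross x y).symm
  rw [← h1, nondegenerate_prod_iff, nondegenerate_lineForm_iff]

/-! ### Two complements of a line in the radical -/

/-- The projection along `ξ` of `ker ℓ₁` into `ker ℓ₂`: `v ↦ v - (ℓ₂ v / ℓ₂ ξ) ξ`. [folklore] -/
def kerProj (ξ : E) (ℓ₁ ℓ₂ : E →ₗ[ℝ] ℝ) (h₂ : ℓ₂ ξ ≠ 0) : LinearMap.ker ℓ₁ →ₗ[ℝ] LinearMap.ker ℓ₂ :=
  LinearMap.codRestrict (LinearMap.ker ℓ₂)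
    ((LinearMap.id - (LinearMap.toSpanSingleton ℝ E ξ).comp ((ℓ₂ ξ)⁻¹ • ℓ₂)).comp
      (LinearMap.ker ℓ₁).subtype)
    (fun v => by
      rw [LinearMap.mem_ker]
      have : (ℓ₂ ξ)⁻¹ * ℓ₂ (v : E) * ℓ₂ ξ = ℓ₂ (v : E) := by field_simp
      simp [map_sub, map_smul, this])

/-- `kerProj ξ ℓ₁ ℓ₂ h₂ v = v - (ℓ₂ v / ℓ₂ ξ) ξ`. [folklore] -/
theorem kerProj_apply (ξ : E) (ℓ₁ ℓ₂ : E →ₗ[ℝ] ℝ) (h₂ : ℓ₂ ξ ≠ 0) (v : LinearMap.ker ℓ₁) :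
    (kerProj ξ ℓ₁ ℓ₂ h₂ v : E) = (v : E) - ((ℓ₂ ξ)⁻¹ * ℓ₂ v) • ξ := by
  simp [kerProj]

/-- The two projections along `ξ` are inverse to each other. [folklore] -/
theorem kerProj_kerProj (ξ : E) (ℓ₁ ℓ₂ : E →ₗ[ℝ] ℝ) (h₁ : ℓ₁ ξ ≠ 0) (h₂ : ℓ₂ ξ ≠ 0)
    (v : LinearMap.ker ℓ₁) : kerProj ξ ℓ₂ ℓ₁ h₁ (kerProj ξ ℓ₁ ℓ₂ h₂ v) = v := by
  apply Subtype.ext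
  have hv : ℓ₁ v = 0 := LinearMap.mem_ker.1 v.2
  rw [kerProj_apply, kerProj_apply, map_sub, map_smul, hv, smul_eq_mul, zero_sub]
  have : (ℓ₁ ξ)⁻¹ * -((ℓ₂ ξ)⁻¹ * ℓ₂ (v : E) * ℓ₁ ξ) = -((ℓ₂ ξ)⁻¹ * ℓ₂ (v : E)) := by field_simp
  rw [this, neg_smul, sub_neg_eq_add, sub_add_cancel]

/-- **The projection along `ξ`** as a linear isomorphism `ker ℓ₁ ≃ ker ℓ₂`. [folklore] -/
def kerProjEquiv (ξ : E) (ℓ₁ ℓ₂ : E →ₗ[ℝ] ℝ) (h₁ : ℓ₁ ξ ≠ 0) (h₂ : ℓ₂ ξ ≠ 0) :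
    LinearMap.ker ℓ₁ ≃ₗ[ℝ] LinearMap.ker ℓ₂ :=
  { kerProj ξ ℓ₁ ℓ₂ h₂ with
    invFun := kerProj ξ ℓ₂ ℓ₁ h₁
    left_inv := fun v => kerProj_kerProj ξ ℓ₁ ℓ₂ h₁ h₂ v
    right_inv := fun v => kerProj_kerProj ξ ℓ₂ ℓ₁ h₂ h₁ v }

/-- `kerProjEquiv` acts as `kerProj`. [folklore] -/
theorem kerProjEquiv_apply (ξ : E) (ℓ₁ ℓ₂ : E →ₗ[ℝ] ℝ) (h₁ : ℓ₁ ξ ≠ 0) (h₂ : ℓ₂ ξ ≠ 0)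
    (v : LinearMap.ker ℓ₁) :
    (kerProjEquiv ξ ℓ₁ ℓ₂ h₁ h₂ v : E) = (v : E) - ((ℓ₂ ξ)⁻¹ * ℓ₂ v) • ξ :=
  kerProj_apply ξ ℓ₁ ℓ₂ h₂ v

/-- **A line in the radical: all complements see the same form.**  If `Q(ξ, ·) = Q(·, ξ) = 0`
then the restrictions of `Q` to `ker ℓ₁` and `ker ℓ₂` (`ℓᵢ ξ ≠ 0`) agree along the projection
along `ξ`. [cite: Milnor1963, §2] -/
theorem restrict_apply_kerProjEquiv (Q : LinearMap.BilinForm ℝ E) {ξ : E} (hQ : ∀ v, Q ξ v = 0 ∧ Q v ξ = 0)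
    (ℓ₁ ℓ₂ : E →ₗ[ℝ] ℝ) (h₁ : ℓ₁ ξ ≠ 0) (h₂ : ℓ₂ ξ ≠ 0) (v w : LinearMap.ker ℓ₁) :
    Q.restrict (LinearMap.ker ℓ₂) (kerProjEquiv ξ ℓ₁ ℓ₂ h₁ h₂ v) (kerProjEquiv ξ ℓ₁ ℓ₂ h₁ h₂ w) =
      Q.restrict (LinearMap.ker ℓ₁) v w := by
  simp only [restrict_apply, LinearMap.domRestrict_apply, kerProjEquiv_apply, map_sub, map_smul,
    LinearMap.sub_apply, LinearMap.smul_apply, (hQ _).1, (hQ _).2, smul_zero, sub_zero]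

/-- **`b⁻` of the restriction to a complement of a radical line is independent of the
complement.** [cite: Milnor1963, §2] -/
theorem sigNeg_restrict_ker_eq_of_radical [FiniteDimensional ℝ E] (Q : LinearMap.BilinForm ℝ E)
    {ξ : E} (hQ : ∀ v, Q ξ v = 0 ∧ Q v ξ = 0) {ℓ₁ ℓ₂ : E →ₗ[ℝ] ℝ} (h₁ : ℓ₁ ξ ≠ 0) (h₂ : ℓ₂ ξ ≠ 0) :
    sigNeg (Q.restrict (LinearMap.ker ℓ₁)).toQuadraticMap =
      sigNeg (Q.restrict (LinearMap.ker ℓ₂)).toQuadraticMap :=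
  sigNeg_eq_of_forall_apply_eq (kerProjEquiv ξ ℓ₁ ℓ₂ h₁ h₂)
    fun v w => (Q.restrict_apply_kerProjEquiv hQ ℓ₁ ℓ₂ h₁ h₂ v w).symm

/-- Nondegeneracy of the restriction to a complement of a radical line is independent of the
complement. [cite: Milnor1963, §2] -/
theorem nondegenerate_restrict_ker_iff_of_radical (Q : LinearMap.BilinForm ℝ E)
    {ξ : E} (hQ : ∀ v, Q ξ v = 0 ∧ Q v ξ = 0) {ℓ₁ ℓ₂ : E →ₗ[ℝ] ℝ} (h₁ : ℓ₁ ξ ≠ 0) (h₂ : ℓ₂ ξ ≠ 0) :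
    (Q.restrict (LinearMap.ker ℓ₁)).Nondegenerate ↔ (Q.restrict (LinearMap.ker ℓ₂)).Nondegenerate :=
  nondegenerate_iff_of_forall_apply_eq (kerProjEquiv ξ ℓ₁ ℓ₂ h₁ h₂)
    fun v w => (Q.restrict_apply_kerProjEquiv hQ ℓ₁ ℓ₂ h₁ h₂ v w).symm

/-! ### Transport of restricted forms under a linear isomorphism -/

variable {E' : Type*} [AddCommGroup E'] [Module ℝ E']

/-- If `ℓ' ∘ A = c ℓ` with `c ≠ 0` then `A` maps `ker ℓ` onto `ker ℓ'`. [folklore] -/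
theorem map_ker_eq_of_comp_eq_smul (A : E ≃ₗ[ℝ] E') {ℓ : E →ₗ[ℝ] ℝ} {ℓ' : E' →ₗ[ℝ] ℝ} {c : ℝ}
    (hc : c ≠ 0) (h : ℓ'.comp (A : E →ₗ[ℝ] E') = c • ℓ) :
    (LinearMap.ker ℓ).map (A : E →ₗ[ℝ] E') = LinearMap.ker ℓ' := by
  ext w
  simp only [Submodule.mem_map, LinearMap.mem_ker, LinearEquiv.coe_coe]
  constructor
  · rintro ⟨v, hv, rfl⟩
    have := LinearMap.congr_fun h v
    rw [LinearMap.comp_apply, LinearMap.smul_apply, hv, smul_zero] at this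
    exact this
  · intro hw
    refine ⟨A.symm w, ?_, A.apply_symm_apply w⟩
    have := LinearMap.congr_fun h (A.symm w)
    rw [LinearMap.comp_apply, LinearMap.smul_apply, smul_eq_mul] at this
    have h' : ℓ' ((A : E →ₗ[ℝ] E') (A.symm w)) = 0 := by
      rw [LinearEquiv.coe_coe, A.apply_symm_apply]; exact hw
    rw [h'] at this
    exact (mul_eq_zero.1 this.symm).resolve_left hc

/-- **Transport of restricted forms.**  For a linear isomorphism `A` with `ℓ' ∘ A = c ℓ`
(`c ≠ 0`) and forms with `B(v, w) = B'(A v, A w)`, the restrictions of `B` to `ker ℓ` and of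
`B'` to `ker ℓ'` have the same `b⁻`. [cite: Milnor1963, §2] -/
theorem sigNeg_restrict_ker_eq_of_comp [FiniteDimensional ℝ E] [FiniteDimensional ℝ E']
    (A : E ≃ₗ[ℝ] E') {ℓ : E →ₗ[ℝ] ℝ} {ℓ' : E' →ₗ[ℝ] ℝ} {c : ℝ} (hc : c ≠ 0)
    (h : ℓ'.comp (A : E →ₗ[ℝ] E') = c • ℓ) {B : LinearMap.BilinForm ℝ E} {B' : LinearMap.BilinForm ℝ E'}
    (hBB' : ∀ v w, B v w = B' (A v) (A w)) :
    sigNeg (B.restrict (LinearMap.ker ℓ)).toQuadraticMap =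
      sigNeg (B'.restrict (LinearMap.ker ℓ')).toQuadraticMap := by
  set L : LinearMap.ker ℓ ≃ₗ[ℝ] LinearMap.ker ℓ' :=
    (A.submoduleMap (LinearMap.ker ℓ)).trans (LinearEquiv.ofEq _ _ (map_ker_eq_of_comp_eq_smul A hc h))
  refine sigNeg_eq_of_forall_apply_eq L fun v w => ?_
  simp only [restrict_apply, LinearMap.domRestrict_apply, hBB']
  rfl

/-- Transport of nondegeneracy of restricted forms under `A` with `ℓ' ∘ A = c ℓ`. [cite: Milnor1963, §2] -/
theorem nondegenerate_restrict_ker_iff_of_comp (A : E ≃ₗ[ℝ] E') {ℓ : E →ₗ[ℝ] ℝ} {ℓ' : E' →ₗ[ℝ] ℝ}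
    {c : ℝ} (hc : c ≠ 0) (h : ℓ'.comp (A : E →ₗ[ℝ] E') = c • ℓ) {B : LinearMap.BilinForm ℝ E}
    {B' : LinearMap.BilinForm ℝ E'} (hBB' : ∀ v w, B v w = B' (A v) (A w)) :
    (B.restrict (LinearMap.ker ℓ)).Nondegenerate ↔ (B'.restrict (LinearMap.ker ℓ')).Nondegenerate := by
  set L : LinearMap.ker ℓ ≃ₗ[ℝ] LinearMap.ker ℓ' :=
    (A.submoduleMap (LinearMap.ker ℓ)).trans (LinearEquiv.ofEq _ _ (map_ker_eq_of_comp_eq_smul A hc h))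
  refine nondegenerate_iff_of_forall_apply_eq L fun v w => ?_
  simp only [restrict_apply, LinearMap.domRestrict_apply, hBB']
  rfl

/-! ### Negative multiples -/

/-- **`b⁻(c Q) = dim − b⁻(Q)` for `c < 0`** and `Q` nondegenerate symmetric on a
finite-dimensional real space (Sylvester: `b⁺ + b⁻ = dim`, and `b⁻(c Q) = b⁺(Q)`). [cite: Milnor1963, §2] -/
theorem sigNeg_smul_of_neg {V : Type*} [AddCommGroup V] [Module ℝ V] [FiniteDimensional ℝ V]
    {B : LinearMap.BilinForm ℝ V} (hB : B.Nondegenerate) (hs : B.IsSymm) {c : ℝ} (hc : c < 0) :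
    sigNeg (c • B).toQuadraticMap + sigNeg B.toQuadraticMap = Module.finrank ℝ V := by
  have h1 : (c • B).toQuadraticMap = -((-c) • B.toQuadraticMap) := by
    ext v; simp
  have hs' : LinearMap.IsSymm B := ⟨fun x y => hs.eq x y⟩
  rw [h1, sigNeg_neg, Literature.Topology.FourManifolds.sigPos_smul (neg_pos.2 hc)]
  exact Literature.Topology.FourManifolds.sigPos_add_sigNeg_of_nondegenerate_of_isSymm hB hs'

/-- `b⁻(c Q) = b⁻(Q)` for `c > 0` (bilinear-form version of `sigNeg_smul`). [folklore] -/
theorem sigNeg_smul_of_pos' {V : Type*} [AddCommGroup V] [Module ℝ V] [FiniteDimensional ℝ V]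
    (B : LinearMap.BilinForm ℝ V) {c : ℝ} (hc : 0 < c) :
    sigNeg (c • B).toQuadraticMap = sigNeg B.toQuadraticMap := by
  have h1 : (c • B).toQuadraticMap = c • B.toQuadraticMap := by
    ext v; simp
  rw [h1, Literature.Topology.FourManifolds.sigNeg_smul hc]

/-- `c • B` is nondegenerate iff `B` is (`c ≠ 0`). [folklore] -/
theorem nondegenerate_smul_iff {V : Type*} [AddCommGroup V] [Module ℝ V] (B : LinearMap.BilinForm ℝ V)
    {c : ℝ} (hc : c ≠ 0) : (c • B).Nondegenerate ↔ B.Nondegenerate := by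
  have key : ∀ v w, (c • B) v w = c * B v w := fun v w => rfl
  constructor
  · rintro ⟨h1, h2⟩
    refine ⟨fun v hv => h1 v fun w => ?_, fun v hv => h2 v fun w => ?_⟩
    · rw [key, hv w, mul_zero]
    · rw [key, hv w, mul_zero]
  · rintro ⟨h1, h2⟩
    refine ⟨fun v hv => h1 v fun w => ?_, fun v hv => h2 v fun w => ?_⟩
    · have := hv w; rw [key] at this; exact (mul_eq_zero.1 this).resolve_left hc
    · have := hv w; rw [key] at this; exact (mul_eq_zero.1 this).resolve_left hc

end LinearMap.BilinForm

/-! ### Chain rules for a function of two scalar functions -/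

namespace Literature.Topology.FourManifolds

section Calculus

variable {E : Type*} [NormedAddCommGroup E] [NormedSpace ℝ E]

/-- First partial derivative of `Γ : ℝ × ℝ → ℝ`. [folklore] -/
abbrev partialFst (Γ : ℝ × ℝ → ℝ) (p : ℝ × ℝ) : ℝ := fderiv ℝ Γ p (1, 0)

/-- Second partial derivative of `Γ : ℝ × ℝ → ℝ` (in the second variable). [folklore] -/
abbrev partialSnd (Γ : ℝ × ℝ → ℝ) (p : ℝ × ℝ) : ℝ := fderiv ℝ Γ p (0, 1)

/-- `DΓ_p (s, t) = s ∂₁Γ + t ∂₂Γ`. [folklore] -/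
theorem fderiv_prod_apply (Γ : ℝ × ℝ → ℝ) (p : ℝ × ℝ) (s t : ℝ) :
    fderiv ℝ Γ p (s, t) = s * partialFst Γ p + t * partialSnd Γ p := by
  have h : ((s, t) : ℝ × ℝ) = s • ((1 : ℝ), (0 : ℝ)) + t • ((0 : ℝ), (1 : ℝ)) := by
    ext <;> simp
  rw [h, map_add, map_smul, map_smul, smul_eq_mul, smul_eq_mul]

/-- **First-order chain rule** for `u ↦ Γ(g u, h u)`:
`D(Γ ∘ (g, h))_u v = ∂₁Γ · Dg_u v + ∂₂Γ · Dh_u v`. [folklore] -/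
theorem fderiv_comp₂_apply {Γ : ℝ × ℝ → ℝ} {g h : E → ℝ} {u : E}
    (hΓ : DifferentiableAt ℝ Γ (g u, h u)) (hg : DifferentiableAt ℝ g u) (hh : DifferentiableAt ℝ h u)
    (v : E) :
    fderiv ℝ (fun u => Γ (g u, h u)) u v =
      partialFst Γ (g u, h u) * fderiv ℝ g u v + partialSnd Γ (g u, h u) * fderiv ℝ h u v := by
  have hτ : DifferentiableAt ℝ (fun u => (g u, h u)) u := hg.prodMk hh
  have hcomp : fderiv ℝ (fun u => Γ (g u, h u)) u = (fderiv ℝ Γ (g u, h u)).comp (fderiv ℝ (fun u => (g u, h u)) u) :=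
    fderiv_comp u hΓ hτ
  rw [hcomp, ContinuousLinearMap.comp_apply, hg.fderiv_prodMk hh]
  simp only [ContinuousLinearMap.prod_apply]
  rw [fderiv_prod_apply]
  ring

/-- **Second-order chain rule at a point where `Dg = 0` and `∂₂Γ = 0`**:
`D²(Γ ∘ (g, h))_u (v, w) = ∂₂₂Γ · Dh v · Dh w + ∂₁Γ · D²g (v, w)` — the form of the Hessian of a
function `Γ(φ̄, f)` of a flow-invariant `φ̄` and the Morse function `f` at a point critical for
`φ̄` and with `∂₂Γ = 0`. [cite: Milnor1963, §2] -/
theorem fderiv_fderiv_comp₂_apply_of_fderiv_eq_zero {Γ : ℝ × ℝ → ℝ} {g h : E → ℝ} {u : E}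
    (hΓ : ContDiffAt ℝ 2 Γ (g u, h u)) (hg : ContDiffAt ℝ 2 g u) (hh : ContDiffAt ℝ 2 h u)
    (hg0 : fderiv ℝ g u = 0) (hΓ2 : partialSnd Γ (g u, h u) = 0) (v w : E) :
    fderiv ℝ (fderiv ℝ (fun u => Γ (g u, h u))) u v w =
      fderiv ℝ (fderiv ℝ Γ) (g u, h u) (0, fderiv ℝ h u v) (0, fderiv ℝ h u w) +
        partialFst Γ (g u, h u) * fderiv ℝ (fderiv ℝ g) u v w := by
  have hτ : ContDiffAt ℝ 2 (fun u => (g u, h u)) u := hg.prodMk hh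
  have key := fderiv_fderiv_comp_apply (F := Γ) (τ := fun u => (g u, h u)) hΓ hτ v w
  have hcomp : (Γ ∘ fun u => (g u, h u)) = fun u => Γ (g u, h u) := rfl
  rw [hcomp] at key
  rw [key]
  -- first derivative of `τ`
  have hgd : DifferentiableAt ℝ g u := hg.differentiableAt (by norm_num)
  have hhd : DifferentiableAt ℝ h u := hh.differentiableAt (by norm_num)
  have hDτ : ∀ x, fderiv ℝ (fun u => (g u, h u)) u x = (0, fderiv ℝ h u x) := fun x => by
    rw [hgd.fderiv_prodMk hhd]
    simp [hg0]
  -- second derivative of `τ`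
  have hD2τ : fderiv ℝ (fderiv ℝ (fun u => (g u, h u))) u v w =
      (fderiv ℝ (fderiv ℝ g) u v w, fderiv ℝ (fderiv ℝ h) u v w) := by
    have hev : fderiv ℝ (fun u => (g u, h u)) =ᶠ[nhds u]
        fun u => (fderiv ℝ g u).prod (fderiv ℝ h u) := by
      have hgd' : ∀ᶠ u' in nhds u, DifferentiableAt ℝ g u' :=
        (hg.eventually (by simp)).mono fun u' hu' => hu'.differentiableAt (by simp)
      have hhd' : ∀ᶠ u' in nhds u, DifferentiableAt ℝ h u' :=
        (hh.eventually (by simp)).mono fun u' hu' => hu'.differentiableAt (by simp)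
      filter_upwards [hgd', hhd'] with u' hu₁ hu₂
      exact hu₁.fderiv_prodMk hu₂
    rw [hev.fderiv_eq]
    have h1 : DifferentiableAt ℝ (fderiv ℝ g) u :=
      (hg.fderiv_right (m := 1) (by norm_num)).differentiableAt (by simp)
    have h2 : DifferentiableAt ℝ (fderiv ℝ h) u :=
      (hh.fderiv_right (m := 1) (by norm_num)).differentiableAt (by simp)
    set P : ((E →L[ℝ] ℝ) × (E →L[ℝ] ℝ)) →L[ℝ] (E →L[ℝ] ℝ × ℝ) :=
      (ContinuousLinearMap.prodₗᵢ ℝ :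
        ((E →L[ℝ] ℝ) × (E →L[ℝ] ℝ)) ≃ₗᵢ[ℝ] (E →L[ℝ] ℝ × ℝ)).toContinuousLinearEquiv.toContinuousLinearMap
      with hP
    have hfun : (fun u => (fderiv ℝ g u).prod (fderiv ℝ h u)) =
        P ∘ fun u => (fderiv ℝ g u, fderiv ℝ h u) := rfl
    have h3 : HasFDerivAt (P ∘ fun u => (fderiv ℝ g u, fderiv ℝ h u))
        (P.comp ((fderiv ℝ (fderiv ℝ g) u).prod (fderiv ℝ (fderiv ℝ h) u))) u :=
      P.hasFDerivAt.comp u (h1.hasFDerivAt.prodMk h2.hasFDerivAt)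
    rw [hfun, h3.fderiv]
    rfl
  rw [hDτ v, hDτ w, hD2τ, fderiv_prod_apply, hΓ2]
  ring

end Calculus

end Literature.Topology.FourManifolds

end
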